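import Summits.FinalStateConjecture.FinalStateConjecture.Theorems.EIHFluxBalanceInertialRecessionStubEndgameOracleSlowGroup

/-!
# Route EIHFluxBalance — crux `InertialRecession`, line `sublinear-is-free-clean-window-charges`:
# the ABSTRACT endgame modulo an INCREMENT ORACLE — all velocities converge, hence the pairwise dichotomy

Helper file for the crux `stmt-FinalStateConjecture-10166`
(`Summit.FinalStateConjecture.FinalStateConjecture.Theses.EIHFluxBalance.InertialRecession`), registered stub
`stub_pairwiseDichotomy` (lead reshape r7) of `Cruxes/InertialRecession/Lines/sublinear_is_free_clean_window_charges.lean`;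
third file of the oracle series (`…OracleCross`, `…OracleSlowGroup`).

`tendsto_velocity_of_oracle` / `pairwiseDichotomy_of_oracle`: for the crux's abstract expanding system of charges (smooth centres,
continuous velocities of norm `≤ k < 1`, slaving `ξ̇ᵢ − vᵢ → 0`), the INCREMENT ORACLE at ratio `Q ≥ 400` —

  for every `Ω > 0` and every floor `W_lo > 0` there is a late time `T₀` after which, for every member set `S`, every interval
  `[t₁,t₂]` and every `W ≥ W_lo`: internal speeds `≤ 30W/Q` on `[t₁,t₂]` and ballistic (member, outsider) pairs with floor `W/2`
  (derivative level, fixed unit directions) imply that `Σ_S Mⱼγⱼvⱼ` and `Σ_S Mⱼγⱼ` change by at most `Ω` —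

implies that EVERY velocity converges, hence the registered PAIRWISE DICHOTOMY (`dichotomy_of_tendsto_velocity`). Proof = the
top level of the toy (cf. `…ToyFrozen`) over the abstract lemmas: worst-case constants from `η`, lateness from the oracle and from
slaving, the empty band at the late time over all bodies, `oracleCrossBootstrap` at level `N` with `oracleSlowGroup`, uniform Cauchy
control, completeness. So `stub_pairwiseDichotomy` (every `N`) is reduced to the oracle, i.e. to the window law + identification
supplying the increments of slow, ballistically isolated member sets — one admissible window suffices for `N ≤ 2`; in general this is
the piece machinery of the lead's roadmap (`Endgame_generalN_roadmap.md` §4, §7).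
-/

noncomputable section

set_option linter.dupNamespace false

open Filter Topology Set MeasureTheory
open scoped Topology BigOperators InnerProductSpace RealInnerProductSpace

namespace Summit.FinalStateConjecture.FinalStateConjecture.Theorems.SublinearIsFree.Oracle

open Literature.Geometry.Lorentzian
open Summit.FinalStateConjecture.FinalStateConjecture.Theorems.SublinearIsFree.Endgame
open Summit.FinalStateConjecture.FinalStateConjecture.Theorems.SublinearIsFree.Toy

/-- Uniform Cauchy control of a velocity after late times gives a limit velocity (`E3` is complete). [folklore] -/
theorem exists_tendsto_velocity_of_uniform_control (f : ℝ → E3)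
    (h : ∀ η : ℝ, 0 < η → ∃ T : ℝ, ∀ t, T ≤ t → ‖f t - f T‖ ≤ η) : ∃ V : E3, Tendsto f atTop (𝓝 V) := by
  have hc : Cauchy (map f atTop) := by
    rw [Metric.cauchy_iff]
    refine ⟨map_neBot, fun ε hε ↦ ?_⟩
    obtain ⟨T, hT⟩ := h (ε / 4) (by positivity)
    refine ⟨f '' Ici T, image_mem_map (Ici_mem_atTop T), ?_⟩
    rintro x ⟨t, ht, rfl⟩ y ⟨s, hs, rfl⟩
    rw [dist_eq_norm]
    calc ‖f t - f s‖ = ‖(f t - f T) - (f s - f T)‖ := by abel_nf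
      _ ≤ ‖f t - f T‖ + ‖f s - f T‖ := norm_sub_le _ _
      _ < ε := by linarith [hT t ht, hT s hs]
  exact cauchy_map_iff_exists_tendsto.mp hc

set_option maxHeartbeats 800000 in
/-- **ALL VELOCITIES CONVERGE, modulo the increment oracle** (abstract expanding system of charges, every `N`). See the
module docstring. [folklore] -/
theorem tendsto_velocity_of_oracle {N : ℕ} (M : Fin N → ℝ) (ξ v : Fin N → ℝ → E3) (Q : ℝ)
    (hM : ∀ i, 0 < M i) (hQ : 400 ≤ Q) (hvc : ∀ i, Continuous (v i))
    (hk : ∃ k : ℝ, 0 ≤ k ∧ k < 1 ∧ ∀ i t, ‖v i t‖ ≤ k)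
    (hslave : ∀ i, Tendsto (fun t ↦ deriv (ξ i) t - v i t) atTop (𝓝 0))
    (hOR : ∀ Ω : ℝ, 0 < Ω → ∀ Wlo : ℝ, 0 < Wlo → ∃ T₀ : ℝ, ∀ (S : Finset (Fin N)) (t₁ t₂ W : ℝ),
      T₀ ≤ t₁ → t₁ ≤ t₂ → Wlo ≤ W → S.Nonempty →
      (∀ s ∈ Icc t₁ t₂, ∀ k ∈ S, ∀ l ∈ S, ‖v k s - v l s‖ ≤ 30 * W / Q) →
      (∀ i ∈ S, ∀ j ∉ S, ∃ n : E3, ‖n‖ = 1 ∧ ∀ s ∈ Icc t₁ t₂, W / 2 ≤ ⟪deriv (ξ j) s - deriv (ξ i) s, n⟫) →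
      ‖∑ j ∈ S, (M j * (√(1 - ‖v j t₂‖ ^ 2))⁻¹) • v j t₂ - ∑ j ∈ S, (M j * (√(1 - ‖v j t₁‖ ^ 2))⁻¹) • v j t₁‖ ≤ Ω ∧
      |∑ j ∈ S, M j * (√(1 - ‖v j t₂‖ ^ 2))⁻¹ - ∑ j ∈ S, M j * (√(1 - ‖v j t₁‖ ^ 2))⁻¹| ≤ Ω) :
    ∀ i, ∃ V : E3, Tendsto (v i) atTop (𝓝 V) := by
  classical
  intro i
  obtain ⟨k₀, -, hk₀, hvk⟩ := hk
  -- sizes and the minimal mass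
  have hNpos : 0 < N := Fin.pos i
  have hN1 : (1 : ℝ) ≤ N := by exact_mod_cast hNpos
  have hN0 : (0 : ℝ) < N := by linarith
  have hQ0 : (0 : ℝ) < Q := by linarith
  have hQ1 : (1 : ℝ) ≤ Q := by linarith
  obtain ⟨mmin, hmmin, hmle⟩ : ∃ mmin : ℝ, 0 < mmin ∧ ∀ j, mmin ≤ M j := by
    obtain ⟨j₀, -, hj₀⟩ := Finset.exists_min_image Finset.univ M ⟨i, Finset.mem_univ _⟩
    exact ⟨M j₀, hM j₀, fun j ↦ hj₀ j (Finset.mem_univ _)⟩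
  refine exists_tendsto_velocity_of_uniform_control (v i) fun η hη ↦ ?_
  -- opaque base power and worst-case constants from `η`
  set P : ℝ := Q ^ (N ^ 3 + N) with hP
  have hP1 : 1 ≤ P := one_le_pow₀ hQ1
  have hPpos : 0 < P := by positivity
  set c₁ : ℝ := Q ^ (N * N + 1) with hc₁
  have hc₁pos : 0 < c₁ := by positivity
  set c₂ : ℝ := 48 * N * P with hc₂
  have hc₂pos : 0 < c₂ := by positivity
  set θgm : ℝ := η / c₁ / c₂ with hθgm
  have hθgmpos : 0 < θgm := by positivity
  set Ω : ℝ := mmin * θgm / 2 with hΩdef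
  have hΩpos : 0 < Ω := by positivity
  set estar : ℝ := Q * θgm / 16 with hestar
  have hestarpos : 0 < estar := by positivity
  -- lateness: the oracle and the slaving errors
  obtain ⟨T₀, hT₀⟩ := hOR Ω hΩpos (Q * θgm / 2) (by positivity)
  obtain ⟨Te, hTe⟩ : ∃ Te : ℝ, ∀ j s, Te ≤ s → ‖deriv (ξ j) s - v j s‖ ≤ estar := by
    have hev : ∀ᶠ s in atTop, ∀ j, ‖deriv (ξ j) s - v j s‖ ≤ estar := by
      rw [Filter.eventually_all]
      intro j
      have h := (hslave j).norm
      rw [norm_zero] at h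
      exact h.eventually (eventually_le_nhds hestarpos)
    obtain ⟨Te, hTe⟩ := eventually_atTop.mp hev
    exact ⟨Te, fun j s hs ↦ hTe s hs j⟩
  set T' : ℝ := max T₀ Te with hT'
  -- the empty band at `T'` over all bodies
  have hQ2 : (2 : ℝ) ≤ Q := by linarith
  obtain ⟨θ', hθ'lo, hθ'hi, hθ'pos, hdich, htrans⟩ :=
    exists_gap_finset (Finset.univ : Finset (Fin N)) (fun j ↦ v j T') hη hQ2
  have hcardU : (Finset.univ : Finset (Fin N)).card = N := by simp
  rw [hcardU] at hθ'lo
  -- `θg` and its worst-case lower bound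
  set θg : ℝ := θ' / c₂ with hθg
  have hθgpos : 0 < θg := by positivity
  have hθg_ge : θgm ≤ θg := by
    rw [hθgm, hθg]
    exact div_le_div_of_nonneg_right hθ'lo hc₂pos.le
  -- hypotheses of the slow-group lemma
  have he : 16 * estar ≤ Q * θg := by
    rw [hestar]
    have := mul_le_mul_of_nonneg_left hθg_ge hQ0.le
    linarith
  have hΩ : 2 * Ω ≤ mmin * θg := by
    rw [hΩdef]
    have := mul_le_mul_of_nonneg_left hθg_ge hmmin.le
    linarith
  have herr : ∀ j s, T' ≤ s → ‖deriv (ξ j) s - v j s‖ ≤ estar := fun j s hs ↦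
    hTe j s ((le_max_right _ _).trans hs)
  have hOR' : ∀ (S : Finset (Fin N)) (t₁ t₂ W : ℝ), T' ≤ t₁ → t₁ ≤ t₂ → Q * θg / 2 ≤ W → S.Nonempty →
      (∀ s ∈ Icc t₁ t₂, ∀ k ∈ S, ∀ l ∈ S, ‖v k s - v l s‖ ≤ 30 * W / Q) →
      (∀ i ∈ S, ∀ j ∉ S, ∃ n : E3, ‖n‖ = 1 ∧ ∀ s ∈ Icc t₁ t₂, W / 2 ≤ ⟪deriv (ξ j) s - deriv (ξ i) s, n⟫) →
      ‖∑ j ∈ S, (M j * (√(1 - ‖v j t₂‖ ^ 2))⁻¹) • v j t₂ - ∑ j ∈ S, (M j * (√(1 - ‖v j t₁‖ ^ 2))⁻¹) • v j t₁‖ ≤ Ω ∧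
      |∑ j ∈ S, M j * (√(1 - ‖v j t₂‖ ^ 2))⁻¹ - ∑ j ∈ S, M j * (√(1 - ‖v j t₁‖ ^ 2))⁻¹| ≤ Ω := by
    intro S t₁ t₂ W h1 h2 hW hS hsl hb
    have hWlo : Q * θgm / 2 ≤ W := by
      have := mul_le_mul_of_nonneg_left hθg_ge hQ0.le
      linarith
    exact hT₀ S t₁ t₂ W ((le_max_left _ _).trans h1) h2 hWlo hS hsl hb
  have hΛ := oracleSlowGroup hmle hmmin hk₀ hvk hvc herr hQ hθgpos he hΩ hOR' N
  -- the level-`N` threshold is exactly `θ'`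
  have hthr : 24 * (N + N) * θg * Q ^ (N ^ 3 + N) ≤ θ' := by
    have : 24 * ((N : ℝ) + N) * θg * P = θ' := by
      rw [hθg, hc₂]; field_simp; ring
    rw [← hP]; exact this.le
  refine ⟨T', fun t ht ↦ ?_⟩
  have hdrift := oracleCrossBootstrap (T := T') hvc herr hQ hθgpos he hΛ le_rfl ht hθ'pos
    (fun k _ l _ ↦ hdich k (Finset.mem_univ _) l (Finset.mem_univ _))
    (fun k _ l _ j _ ↦ htrans k (Finset.mem_univ _) l (Finset.mem_univ _) j (Finset.mem_univ _)) hthr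
    (fun k _ ↦ (Finset.card_le_univ _).trans hcardU.le)
    (fun i _ j hj ↦ absurd (Finset.mem_univ j) hj) i (Finset.mem_univ i) t ⟨ht, le_rfl⟩
  -- `12θ' + 12Nθg ≤ η`
  have h1 : 12 * (N : ℝ) * θg ≤ θ' / 4 := by
    have : 12 * (N : ℝ) * θg * (4 * P) = θ' := by
      rw [hθg, hc₂]; field_simp; ring
    nlinarith
  have h2 : θ' ≤ η / 400 := by
    calc θ' ≤ η / Q := hθ'hi
      _ ≤ η / 400 := div_le_div_of_nonneg_left hη.le (by norm_num) hQ
  linarith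

/-- **THE PAIRWISE DICHOTOMY, modulo the increment oracle** (every `N`): the conclusion of the registered
`stub_pairwiseDichotomy` follows from the kinematic hypotheses of the stub and the oracle. [folklore] -/
theorem pairwiseDichotomy_of_oracle {N : ℕ} (M : Fin N → ℝ) (ξ v : Fin N → ℝ → E3) (Q : ℝ)
    (hM : ∀ i, 0 < M i) (hQ : 400 ≤ Q)
    (hsmooth : ∀ i, ContDiff ℝ ((⊤ : ℕ∞) : WithTop ℕ∞) (ξ i)) (hvc : ∀ i, Continuous (v i))
    (hk : ∃ k : ℝ, 0 ≤ k ∧ k < 1 ∧ ∀ i t, ‖v i t‖ ≤ k)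
    (hslave : ∀ i, Tendsto (fun t ↦ deriv (ξ i) t - v i t) atTop (𝓝 0))
    (hOR : ∀ Ω : ℝ, 0 < Ω → ∀ Wlo : ℝ, 0 < Wlo → ∃ T₀ : ℝ, ∀ (S : Finset (Fin N)) (t₁ t₂ W : ℝ),
      T₀ ≤ t₁ → t₁ ≤ t₂ → Wlo ≤ W → S.Nonempty →
      (∀ s ∈ Icc t₁ t₂, ∀ k ∈ S, ∀ l ∈ S, ‖v k s - v l s‖ ≤ 30 * W / Q) →
      (∀ i ∈ S, ∀ j ∉ S, ∃ n : E3, ‖n‖ = 1 ∧ ∀ s ∈ Icc t₁ t₂, W / 2 ≤ ⟪deriv (ξ j) s - deriv (ξ i) s, n⟫) →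
      ‖∑ j ∈ S, (M j * (√(1 - ‖v j t₂‖ ^ 2))⁻¹) • v j t₂ - ∑ j ∈ S, (M j * (√(1 - ‖v j t₁‖ ^ 2))⁻¹) • v j t₁‖ ≤ Ω ∧
      |∑ j ∈ S, M j * (√(1 - ‖v j t₂‖ ^ 2))⁻¹ - ∑ j ∈ S, M j * (√(1 - ‖v j t₁‖ ^ 2))⁻¹| ≤ Ω) :
    ∀ i j : Fin N, (∃ σ : ℝ, 0 < σ ∧ ∀ᶠ t in atTop, σ * t ≤ ‖ξ j t - ξ i t‖) ∨
      Tendsto (fun t ↦ v j t - v i t) atTop (𝓝 0) :=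
  dichotomy_of_tendsto_velocity N ξ v hsmooth hslave
    (tendsto_velocity_of_oracle M ξ v Q hM hQ hvc hk hslave hOR)

/-- Registered helper form of `pairwiseDichotomy_of_oracle` (the endgame modulo the increment oracle, every `N`). [folklore] -/
theorem endgame_pairwiseDichotomy_of_oracle : open Filter Topology in ∀ (N : ℕ) (M : Fin N → ℝ) (ξ v : Fin N → ℝ → E3) (Q : ℝ), (∀ i, 0 < M i) → 400 ≤ Q → (∀ i, ContDiff ℝ ((⊤ : ℕ∞) : WithTop ℕ∞) (ξ i)) → (∀ i, Continuous (v i)) → (∃ k : ℝ, 0 ≤ k ∧ k < 1 ∧ ∀ i t, ‖v i t‖ ≤ k) → (∀ i, Tendsto (fun t ↦ deriv (ξ i) t - v i t) atTop (𝓝 0)) → (∀ Ω : ℝ, 0 < Ω → ∀ Wlo : ℝ, 0 < Wlo → ∃ T₀ : ℝ, ∀ (S : Finset (Fin N)) (t₁ t₂ W : ℝ), T₀ ≤ t₁ → t₁ ≤ t₂ → Wlo ≤ W → S.Nonempty → (∀ s ∈ Set.Icc t₁ t₂, ∀ k ∈ S, ∀ l ∈ S, ‖v k s - v l s‖ ≤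 30 * W / Q) → (∀ i ∈ S, ∀ j ∉ S, ∃ n : E3, ‖n‖ = 1 ∧ ∀ s ∈ Set.Icc t₁ t₂, W / 2 ≤ inner ℝ (deriv (ξ j) s - deriv (ξ i) s) n) → ‖∑ j ∈ S, (M j * (√(1 - ‖v j t₂‖ ^ 2))⁻¹) • v j t₂ - ∑ j ∈ S, (M j * (√(1 - ‖v j t₁‖ ^ 2))⁻¹) • v j t₁‖ ≤ Ω ∧ |∑ j ∈ S, M j * (√(1 - ‖v j t₂‖ ^ 2))⁻¹ - ∑ j ∈ S, M j * (√(1 - ‖v j t₁‖ ^ 2))⁻¹| ≤ Ω) → ∀ i j : Fin N, (∃ σ : ℝ, 0 < σ ∧ ∀ᶠ t in atTop, σ * t ≤ ‖ξ j t - ξ i t‖) ∨ Tendsto (fun t ↦ v j t - v i t) atTop (𝓝 0) :=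
  fun _ M ξ v Q hM hQ hsmooth hvc hk hslave hOR ↦ pairwiseDichotomy_of_oracle M ξ v Q hM hQ hsmooth hvc hk hslave hOR

end Summit.FinalStateConjecture.FinalStateConjecture.Theorems.SublinearIsFree.Oracle

end
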